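import Summits.ValiantsHypothesis.ValiantsHypothesis.Theorems.LacunarySymmetroidMatrixDescartesCensusDoorA34Letters

/-!
# `MatrixDescartes` census — DOOR A at `(3,4)`: the COEFFICIENT DICTIONARY of a `3 × 3` lacunary pencil

HONEST FRAMING.  Object-search cell `pub-symmetroid`; beside the OPEN typed statement `DoorA34 = PosRootLawAt 3 4 18` (route item
`Theses.LacunarySymmetroid.DoorA34`, stmt-ValiantsHypothesis-19980).  The `(3,4)` analogue of the `(2,6)` dictionary
`Census.coeff_det_pencil_two_diag / _pair` (…CensusSignClass): for real `3 × 3` matrices `S l` and exponents `d`,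

* `coeff_det_pencil_three_fun` — the coefficient of `X^e` in `det (∑ l, X^(d l) • S l)` is the sum, over the column-to-letter maps
  `f : Fin 3 → Fin K` with `∑ᵢ d (f i) = e`, of the column-mixed determinants `det [S (f 0) col 0 | S (f 1) col 1 | S (f 2) col 2]`;
* on an UNCOLLIDED exponent (automatic on a 3-Sidon support, `Census.sym_sum_injective_of_nineteen`): `coeff (2·d i + d k) = tr(adj (S i) · S k)`
  (`coeff_det_pencil_three_square`; `= 3 D(Sᵢ,Sᵢ,S_k)`) and `coeff (d i + d j + d k) = tr((adj (S i + S j) − adj (S i) − adj (S j)) · S k)`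
  (`coeff_det_pencil_three_mixed`; `= 6 D(Sᵢ,Sⱼ,S_k)`), the cube case `coeff (3·d l) = det (S l)` being `Census.coeff_det_pencil_three_mul`.

With F1 (`Census.det_letter_ne_zero_of_nineteen`, `…support_det_pencil_eq_of_nineteen`), C25 (`Census.newton_cone_det_pencil`) and the Gårding
rows N1/N2/N3/G3/G4 (`…CensusGarding*.lean`) this is the vocabulary in which engine-2's LP34 leaf certificates («a 19 on d has no definite
letter») can be replayed per support.  No row is proved here; symmetry is not used; nothing on the all-indefinite residue, on `ζ_sym(3,4)`, on
`MatrixDescartes` (stmt-ValiantsHypothesis-18050) or `VP ≠ VNP`.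

[folklore] Multilinearity of the determinant in its columns; elementary.
-/

-- `Summit.ValiantsHypothesis.ValiantsHypothesis.…` repeats a component by the D-0017 layout
-- (single-conjunct summit), which the `dupNamespace` linter flags; the name is mandated.
set_option linter.dupNamespace false

namespace Summit.ValiantsHypothesis.ValiantsHypothesis.Theorems.LacunarySymmetroidMatrixDescartes.Census

open Polynomial Matrix Finset
open scoped BigOperators Polynomial Matrix

/-- **Coefficients of a `3 × 3` pencil determinant as column-mixed determinants**: the coefficient of `X^e` in
`det (∑ l, X^(d l) • S l)` is `∑_{f : Fin 3 → Fin K, ∑ᵢ d (f i) = e} det (a, b ↦ S (f b) a b)`. [folklore] -/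
theorem coeff_det_pencil_three_fun {K : ℕ} (d : Fin K → ℕ) (S : Fin K → Matrix (Fin 3) (Fin 3) ℝ) (e : ℕ) :
    (Matrix.det (∑ l, ((X : ℝ[X]) ^ d l) • (S l).map C)).coeff e
      = ∑ f ∈ (Finset.univ : Finset (Fin 3 → Fin K)).filter (fun f => (∑ i, d (f i)) = e),
          (Matrix.of fun a b => S (f b) a b).det := by
  rw [coeff_det_pencil, Finset.sum_comm, Finset.sum_filter]
  refine Finset.sum_congr rfl fun f _ => ?_
  by_cases h : (∑ i, d (f i)) = e
  · rw [if_pos h, Matrix.det_apply']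
    refine Finset.sum_congr rfl fun σ _ => ?_
    rw [if_pos h.symm]
    simp only [Matrix.of_apply]
  · rw [if_neg h]
    exact Finset.sum_eq_zero fun σ _ => if_neg (fun h' => h h'.symm)

/-- Two vectors `![a, b, c]` differ when they differ at some index (evaluation). [folklore] -/
theorem vec3_ne {K : ℕ} {a b c a' b' c' : Fin K} (h : a ≠ a' ∨ b ≠ b' ∨ c ≠ c') :
    (![a, b, c] : Fin 3 → Fin K) ≠ ![a', b', c'] := by
  intro heq
  rcases h with h | h | h
  · exact h (by simpa using congrFun heq 0)
  · exact h (by simpa using congrFun heq 1)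
  · exact h (by simpa using congrFun heq 2)

/-- **The SQUARE letter of the dictionary**: on an uncollided exponent `2·d i + d k` (`i ≠ k`) the coefficient of the pencil
determinant is `tr(adj (S i) · S k)` (`= 3 D(Sᵢ,Sᵢ,S_k)`, the `t`-derivative of `det (Sᵢ + t S_k)` at `0`). [folklore] -/
theorem coeff_det_pencil_three_square {K : ℕ} (d : Fin K → ℕ) (S : Fin K → Matrix (Fin 3) (Fin 3) ℝ) {i k : Fin K}
    (hik : i ≠ k)
    (huniq : ∀ f : Fin 3 → Fin K, (∑ t, d (f t)) = 2 * d i + d k → f = ![i, i, k] ∨ f = ![i, k, i] ∨ f = ![k, i, i]) :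
    (Matrix.det (∑ l, ((X : ℝ[X]) ^ d l) • (S l).map C)).coeff (2 * d i + d k) = ((S i).adjugate * S k).trace := by
  rw [coeff_det_pencil_three_fun]
  have hset : (Finset.univ : Finset (Fin 3 → Fin K)).filter (fun f => (∑ t, d (f t)) = 2 * d i + d k)
      = {![i, i, k], ![i, k, i], ![k, i, i]} := by
    ext f
    simp only [Finset.mem_filter, Finset.mem_univ, true_and, Finset.mem_insert, Finset.mem_singleton]
    constructor
    · exact huniq f
    · rintro (rfl | rfl | rfl) <;> simp [Fin.sum_univ_three] <;> ring
  have hn1 : (![i, i, k] : Fin 3 → Fin K) ∉ ({![i, k, i], ![k, i, i]} : Finset (Fin 3 → Fin K)) := by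
    simp only [Finset.mem_insert, Finset.mem_singleton, not_or]
    exact ⟨vec3_ne (Or.inr (Or.inl hik)), vec3_ne (Or.inl hik)⟩
  have hn2 : (![i, k, i] : Fin 3 → Fin K) ∉ ({![k, i, i]} : Finset (Fin 3 → Fin K)) := by
    simp only [Finset.mem_singleton]
    exact vec3_ne (Or.inl hik)
  rw [hset, Finset.sum_insert hn1, Finset.sum_insert hn2, Finset.sum_singleton]
  simp only [Matrix.det_fin_three, Matrix.of_apply, Matrix.cons_val_zero, Matrix.cons_val_one, Matrix.head_cons,
    Matrix.cons_val_two, Matrix.tail_cons, Matrix.trace_fin_three, Matrix.mul_apply, Fin.sum_univ_three,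
    Matrix.adjugate_fin_three, Matrix.cons_val', Matrix.empty_val', Matrix.cons_val_fin_one, Matrix.head_fin_const]
  ring

/-- **The MIXED letter of the dictionary**: on an uncollided exponent `d i + d j + d k` (`i, j, k` pairwise distinct) the coefficient of the
pencil determinant is `tr((adj (S i + S j) − adj (S i) − adj (S j)) · S k)` (`= 6 D(Sᵢ,Sⱼ,S_k)`, the fully polarised determinant). [folklore] -/
theorem coeff_det_pencil_three_mixed {K : ℕ} (d : Fin K → ℕ) (S : Fin K → Matrix (Fin 3) (Fin 3) ℝ) {i j k : Fin K}
    (hij : i ≠ j) (hik : i ≠ k) (hjk : j ≠ k)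
    (huniq : ∀ f : Fin 3 → Fin K, (∑ t, d (f t)) = d i + d j + d k →
      f = ![i, j, k] ∨ f = ![i, k, j] ∨ f = ![j, i, k] ∨ f = ![j, k, i] ∨ f = ![k, i, j] ∨ f = ![k, j, i]) :
    (Matrix.det (∑ l, ((X : ℝ[X]) ^ d l) • (S l).map C)).coeff (d i + d j + d k)
      = (((S i + S j).adjugate - (S i).adjugate - (S j).adjugate) * S k).trace := by
  rw [coeff_det_pencil_three_fun]
  have hset : (Finset.univ : Finset (Fin 3 → Fin K)).filter (fun f => (∑ t, d (f t)) = d i + d j + d k)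
      = {![i, j, k], ![i, k, j], ![j, i, k], ![j, k, i], ![k, i, j], ![k, j, i]} := by
    ext f
    simp only [Finset.mem_filter, Finset.mem_univ, true_and, Finset.mem_insert, Finset.mem_singleton]
    constructor
    · exact huniq f
    · rintro (rfl | rfl | rfl | rfl | rfl | rfl) <;> simp [Fin.sum_univ_three] <;> ring
  have hn1 : (![i, j, k] : Fin 3 → Fin K) ∉ ({![i, k, j], ![j, i, k], ![j, k, i], ![k, i, j], ![k, j, i]} : Finset (Fin 3 → Fin K)) := by
    simp only [Finset.mem_insert, Finset.mem_singleton, not_or]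
    exact ⟨vec3_ne (Or.inr (Or.inl hjk)), vec3_ne (Or.inl hij), vec3_ne (Or.inl hij), vec3_ne (Or.inl hik), vec3_ne (Or.inl hik)⟩
  have hn2 : (![i, k, j] : Fin 3 → Fin K) ∉ ({![j, i, k], ![j, k, i], ![k, i, j], ![k, j, i]} : Finset (Fin 3 → Fin K)) := by
    simp only [Finset.mem_insert, Finset.mem_singleton, not_or]
    exact ⟨vec3_ne (Or.inl hij), vec3_ne (Or.inl hij), vec3_ne (Or.inl hik), vec3_ne (Or.inl hik)⟩
  have hn3 : (![j, i, k] : Fin 3 → Fin K) ∉ ({![j, k, i], ![k, i, j], ![k, j, i]} : Finset (Fin 3 → Fin K)) := by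
    simp only [Finset.mem_insert, Finset.mem_singleton, not_or]
    exact ⟨vec3_ne (Or.inr (Or.inl hik)), vec3_ne (Or.inl hjk), vec3_ne (Or.inl hjk)⟩
  have hn4 : (![j, k, i] : Fin 3 → Fin K) ∉ ({![k, i, j], ![k, j, i]} : Finset (Fin 3 → Fin K)) := by
    simp only [Finset.mem_insert, Finset.mem_singleton, not_or]
    exact ⟨vec3_ne (Or.inl hjk), vec3_ne (Or.inl hjk)⟩
  have hn5 : (![k, i, j] : Fin 3 → Fin K) ∉ ({![k, j, i]} : Finset (Fin 3 → Fin K)) := by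
    simp only [Finset.mem_singleton]
    exact vec3_ne (Or.inr (Or.inl hij))
  rw [hset, Finset.sum_insert hn1, Finset.sum_insert hn2, Finset.sum_insert hn3, Finset.sum_insert hn4, Finset.sum_insert hn5,
    Finset.sum_singleton]
  simp only [Matrix.det_fin_three, Matrix.of_apply, Matrix.cons_val_zero, Matrix.cons_val_one, Matrix.head_cons,
    Matrix.cons_val_two, Matrix.tail_cons, Matrix.trace_fin_three, Matrix.mul_apply, Fin.sum_univ_three, Matrix.sub_apply,
    Matrix.add_apply, Matrix.adjugate_fin_three, Matrix.cons_val', Matrix.empty_val', Matrix.cons_val_fin_one, Matrix.head_fin_const]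
  ring

end Summit.ValiantsHypothesis.ValiantsHypothesis.Theorems.LacunarySymmetroidMatrixDescartes.Census
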